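import Summits.CriticalPhenomena.PercolationContinuityZ3.Theorems.PercNearOneGluingNoHeavyLowerTailSunflowerLinkedCurrency
import HarnessLib

/-!
# `NoHeavyLowerTail` (crux stmt-CriticalPhenomena-4575), abstract sunflower cubic: the linked two-currency
# lemma WITH VOLUNTARY `h`-EXCESS (every number of petals)

Support file (seat `prim-ineq-prove-1` gen 54; `--supports stmt-CriticalPhenomena-4575`); imports the gen-52 file
`…SunflowerLinkedCurrency` (one-coin monotonicity `rfun_anti`).  Memo: run/shared/lean/prim/prim-ineq-prove-1/
FINDING-FREEH-prove1-g54.md §2–§3.  Gen 52's `linked_two_currency` needs EVERY petal linked; gen 53's conjecture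
`FreeHConj` (free `h`, three budgets) is false (gen 54).  The true statement in between, in budget-free form:
* **`linked_two_currency_voluntary`**: parameters `ε_Y, ε_g, ε_h > 0`, `ε_H := ε_g + ε_h < 1`, `ρ > 0`, caps
  `ε_H ≤ (1/ε_Y − 1)ρε_g` (`ε_Y ≤ τ′`), `ε_H + ρε_g ≤ 1` (`ε_H ≤ 1 − τ′`); petals with excesses `a_j, m_j, e_j ≥ 0`
  (`Ȳ`, `g`, VOLUNTARY `h`), links `ρ m_j ≤ a_j` (`k ≥ g`), `ε_h m_j ≤ ε_g e_j` (`g ≤ h`, no free `g`: `κ = 1`), and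
  `ε_h·ε_Y(∏(1 + a_j/ε_Y) − 1) ≤ ε_g` (`c₀ ≥ τσ`).  Then
  `∏(1 + a_j + m_j + e_j) ≤ 1 + ε_Y(∏(1 + a_j/ε_Y) − 1) + ε_H(∏(1 + e_j/ε_h) − 1)` (actual `Ȳ`-face + `h`-cell usage).
* **`freeH_kappa_one`**: `FreeHConj`'s conclusion at `κ = 1` from the `Ȳ`-face and `h`-cell budgets alone.
Proof: insert petals in increasing order of the `h`-share `e_j/(a_j+m_j+e_j)` (`Finset.induction_on_max_value`); the
defect `D_T = 1 + 𝒜_T + ℰ_T − ∏_T V` obeys `D_{T+j} = D_T V_j + Δ_j`, `ε_hΔ_j = (ε_g e_j − ε_h m_j) + ε_h𝒜_Tα_j + ℰ_Tβ_j`;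
`vol_stepF` (first two terms ≥ 0), `vol_Ebound` (`ℰ_T ≤ ε_Hθ_j𝒜_T` when `β_j < 0`, one-coin monotonicity),
`vol_K1`/`vol_stepKey` (the remaining one-petal inequality; a perfect square when both caps are tight).
-/

noncomputable section

namespace Summit.CriticalPhenomena.PercolationContinuityZ3.Theorems.SunflowerPartition

namespace SafeCalc

namespace LinkedCurrency

open Finset

variable {κ : Type*}

/-! ## Three one-petal inequalities -/

/-- Step (i) of the induction: the unused unlocked `g` of a petal plus `𝒜` times its `Ȳ`-heaviness is nonnegative,
`0 ≤ (ε_g e − ε_h m) + ε_h 𝒜 (a Q − m − e)` (`Q = 1/ε_Y − 1`), whenever `ε_h 𝒜 ≤ ε_g`, `ρ m ≤ a`, `ε_h m ≤ ε_g e` and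
the cap `ε_H ≤ Q ρ ε_g`.  Explicit identity:
`ρ ε_g · F = ρ (ε_g e − ε_h m)(ε_g − ε_h 𝒜) + ε_h 𝒜 (a (Qρε_g − ε_H) + ε_H (a − ρ m))`. [this work] -/
theorem vol_stepF {εg εh ρ Q 𝒜 a m e : ℝ} (hεg : 0 < εg) (hεh : 0 < εh) (hρ : 0 < ρ)
    (hQ : εg + εh ≤ Q * (ρ * εg)) (h𝒜 : 0 ≤ 𝒜) (h𝒜g : εh * 𝒜 ≤ εg) (ha : 0 ≤ a)
    (hlink : ρ * m ≤ a) (hunl : εh * m ≤ εg * e) :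
    0 ≤ (εg * e - εh * m) + εh * 𝒜 * (a * Q - m - e) := by
  have key : ρ * εg * ((εg * e - εh * m) + εh * 𝒜 * (a * Q - m - e)) =
      ρ * (εg * e - εh * m) * (εg - εh * 𝒜) +
        εh * 𝒜 * (a * (Q * (ρ * εg) - (εg + εh)) + (εg + εh) * (a - ρ * m)) := by ring
  have h1 : 0 ≤ ρ * (εg * e - εh * m) * (εg - εh * 𝒜) :=
    mul_nonneg (mul_nonneg hρ.le (by linarith)) (by linarith)
  have h2 : 0 ≤ εh * 𝒜 * (a * (Q * (ρ * εg) - (εg + εh)) + (εg + εh) * (a - ρ * m)) :=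
    mul_nonneg (mul_nonneg hεh.le h𝒜)
      (add_nonneg (mul_nonneg ha (by linarith)) (mul_nonneg (by linarith) (by linarith)))
  exact (mul_nonneg_iff_of_pos_left (mul_pos hρ hεg)).1 (key ▸ add_nonneg h1 h2)

/-- The cap-tight certificate.  With `ε_H = ε_g + ε_h < 1`, `λ = 1/ρ`, the two caps in the form `ε_H λ ≤ Q ε_g`,
`ε_g ≤ λ (1 − ε_H)`, and `a, e ≥ 0` with `a ε_h + e ε_g > 0`:
`0 ≤ K := ε_h a Q − ε_H e (2 + λ) + ε_H (1 + λ)(1 − ε_h) e² / (a ε_h + e ε_g)`, because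
`K · ε_g (1 − ε_H)(aε_h + eε_g) = aε_h(aε_h + eε_g)(1 − ε_H)(Qε_g − ε_Hλ) + ε_H(a²ε_h² + e²ε_g(1 − ε_H))(λ(1 − ε_H) − ε_g)`
`+ ε_g ε_H (a ε_h − e (1 − ε_H))²` — a perfect square when both caps are tight. [this work] -/
theorem vol_K1 {εg εh Q lam a e : ℝ} (hεg : 0 < εg) (hεh : 0 < εh) (hH1 : εg + εh < 1)
    (hs1 : (εg + εh) * lam ≤ Q * εg) (hs2 : εg ≤ lam * (1 - (εg + εh))) (ha : 0 ≤ a)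
    (hP : 0 < a * εh + e * εg) :
    0 ≤ εh * a * Q - (εg + εh) * e * (2 + lam) +
      (εg + εh) * (1 + lam) * (1 - εh) * e ^ 2 / (a * εh + e * εg) := by
  have hH1' : 0 < 1 - (εg + εh) := sub_pos.2 hH1
  have hPne : a * εh + e * εg ≠ 0 := hP.ne'
  have e1 : (εg + εh) * (1 + lam) * (1 - εh) * e ^ 2 / (a * εh + e * εg) * (εg * (1 - (εg + εh)) * (a * εh + e * εg)) =
      (εg + εh) * (1 + lam) * (1 - εh) * e ^ 2 * (εg * (1 - (εg + εh))) := by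
    rw [div_mul_eq_mul_div, show (εg + εh) * (1 + lam) * (1 - εh) * e ^ 2 * (εg * (1 - (εg + εh)) * (a * εh + e * εg)) =
      (εg + εh) * (1 + lam) * (1 - εh) * e ^ 2 * (εg * (1 - (εg + εh))) * (a * εh + e * εg) by ring,
      mul_div_assoc, div_self hPne, mul_one]
  have iden : (εh * a * Q - (εg + εh) * e * (2 + lam) +
      (εg + εh) * (1 + lam) * (1 - εh) * e ^ 2 / (a * εh + e * εg)) * (εg * (1 - (εg + εh)) * (a * εh + e * εg)) =
      a * εh * (a * εh + e * εg) * (1 - (εg + εh)) * (Q * εg - (εg + εh) * lam) +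
        (εg + εh) * (a ^ 2 * εh ^ 2 + e ^ 2 * εg * (1 - (εg + εh))) * (lam * (1 - (εg + εh)) - εg) +
        εg * (εg + εh) * (a * εh - e * (1 - (εg + εh))) ^ 2 := by
    rw [add_mul, e1]
    ring
  have hpos : 0 < εg * (1 - (εg + εh)) * (a * εh + e * εg) := mul_pos (mul_pos hεg hH1') hP
  have t1 : 0 ≤ a * εh * (a * εh + e * εg) * (1 - (εg + εh)) * (Q * εg - (εg + εh) * lam) :=
    mul_nonneg (mul_nonneg (mul_nonneg (mul_nonneg ha hεh.le) hP.le) hH1'.le) (by linarith)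
  have t2 : 0 ≤ (εg + εh) * (a ^ 2 * εh ^ 2 + e ^ 2 * εg * (1 - (εg + εh))) * (lam * (1 - (εg + εh)) - εg) :=
    mul_nonneg (mul_nonneg (by linarith) (by positivity)) (by linarith)
  have t3 : 0 ≤ εg * (εg + εh) * (a * εh - e * (1 - (εg + εh))) ^ 2 := by positivity
  have hr : 0 ≤ (εh * a * Q - (εg + εh) * e * (2 + lam) +
      (εg + εh) * (1 + lam) * (1 - εh) * e ^ 2 / (a * εh + e * εg)) * (εg * (1 - (εg + εh)) * (a * εh + e * εg)) := by
    rw [iden]; linarith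
  exact (mul_nonneg_iff_of_pos_right hpos).1 hr

/-- Step (ii) of the induction, the one-petal inequality (`= ε_h·(F + ε_H θ 𝒜 β)` of the memo): for a petal `(a, m, e)`
with `a + m > 0`, `ε_h m ≤ ε_g e`, any `𝒜 ≥ 0`, under the two caps (`λ = 1/ρ` form).  It decreases in `m`; at
`m = ε_g e/ε_h` it is `ε_h 𝒜` times the quantity of `vol_K1`. [this work] -/
theorem vol_stepKey {εg εh Q lam 𝒜 a m e : ℝ} (hεg : 0 < εg) (hεh : 0 < εh) (hH1 : εg + εh < 1)
    (hs1 : (εg + εh) * lam ≤ Q * εg) (hs2 : εg ≤ lam * (1 - (εg + εh))) (hlam : 0 ≤ lam) (h𝒜 : 0 ≤ 𝒜)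
    (ha : 0 ≤ a) (hP : 0 < a + m) (hunl : εh * m ≤ εg * e) :
    0 ≤ εh * (εg * e - εh * m) + εh ^ 2 * 𝒜 * (a * Q - m - e) +
      (εg + εh) * (e * (1 + lam) / (a + m)) * 𝒜 * (e - εh * (a + m + e)) := by
  have hPne : a + m ≠ 0 := hP.ne'
  have hεh1 : 0 ≤ 1 - εh := by linarith
  have hP0 : 0 < a * εh + e * εg := by
    have := mul_pos hεh hP
    nlinarith
  -- expansion of the left side
  have e0 : (εg + εh) * (e * (1 + lam) / (a + m)) * 𝒜 * (e - εh * (a + m + e)) =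
      (εg + εh) * 𝒜 * (1 + lam) * (1 - εh) * e ^ 2 / (a + m) - (εg + εh) * 𝒜 * e * (1 + lam) * εh := by
    have h1 : e - εh * (a + m + e) = (1 - εh) * e - εh * (a + m) := by ring
    rw [h1, mul_sub]
    have h2 : (εg + εh) * (e * (1 + lam) / (a + m)) * 𝒜 * (εh * (a + m)) = (εg + εh) * 𝒜 * e * (1 + lam) * εh := by
      rw [show (εg + εh) * (e * (1 + lam) / (a + m)) * 𝒜 * (εh * (a + m)) =
        (εg + εh) * 𝒜 * e * (1 + lam) * εh * ((a + m) / (a + m)) by ring, div_self hPne, mul_one]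
    have h3 : (εg + εh) * (e * (1 + lam) / (a + m)) * 𝒜 * ((1 - εh) * e) =
        (εg + εh) * 𝒜 * (1 + lam) * (1 - εh) * e ^ 2 / (a + m) := by
      rw [eq_div_iff hPne]
      rw [show (εg + εh) * (e * (1 + lam) / (a + m)) * 𝒜 * ((1 - εh) * e) * (a + m) =
        (εg + εh) * 𝒜 * (1 + lam) * (1 - εh) * e ^ 2 * ((a + m) / (a + m)) by ring, div_self hPne, mul_one]
    rw [h2, h3]
  have hexp : εh * (εg * e - εh * m) + εh ^ 2 * 𝒜 * (a * Q - m - e) +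
      (εg + εh) * (e * (1 + lam) / (a + m)) * 𝒜 * (e - εh * (a + m + e)) =
      εh * 𝒜 * (εh * a * Q - (εg + εh) * e * (2 + lam) +
          (εg + εh) * (1 + lam) * (1 - εh) * e ^ 2 / (a * εh + e * εg)) +
        εh * (εg * e - εh * m) + (εh * 𝒜 * (εg * e) - εh ^ 2 * 𝒜 * m) +
        ((εg + εh) * 𝒜 * (1 + lam) * (1 - εh) * e ^ 2 / (a + m) -
          (εg + εh) * 𝒜 * (1 + lam) * (1 - εh) * e ^ 2 * εh / (a * εh + e * εg)) := by
    rw [e0]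
    ring
  have hK := vol_K1 hεg hεh hH1 hs1 hs2 ha hP0
  have b0 : 0 ≤ εh * 𝒜 * (εh * a * Q - (εg + εh) * e * (2 + lam) +
      (εg + εh) * (1 + lam) * (1 - εh) * e ^ 2 / (a * εh + e * εg)) := mul_nonneg (mul_nonneg hεh.le h𝒜) hK
  have b1 : 0 ≤ εh * (εg * e - εh * m) := mul_nonneg hεh.le (by linarith)
  have b2 : 0 ≤ εh * 𝒜 * (εg * e) - εh ^ 2 * 𝒜 * m := by
    have h := mul_le_mul_of_nonneg_left hunl (mul_nonneg hεh.le h𝒜)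
    have h' : εh ^ 2 * 𝒜 * m = εh * 𝒜 * (εh * m) := by ring
    linarith
  have b3 : 0 ≤ (εg + εh) * 𝒜 * (1 + lam) * (1 - εh) * e ^ 2 / (a + m) -
      (εg + εh) * 𝒜 * (1 + lam) * (1 - εh) * e ^ 2 * εh / (a * εh + e * εg) := by
    have hC : 0 ≤ (εg + εh) * 𝒜 * (1 + lam) * (1 - εh) * e ^ 2 := by positivity
    rw [sub_nonneg, div_le_div_iff₀ hP0 hP]
    have h1 : εh * (a + m) ≤ a * εh + e * εg := by nlinarith
    have h2 := mul_le_mul_of_nonneg_left h1 hC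
    nlinarith
  rw [hexp]
  linarith

/-- One-coin transfer of the predecessors' `h`-usage to their `Ȳ`-usage: if every `i ∈ T` has `e_i ≤ ε_h θ a_i` with
`θ ≥ 0`, `ε_Y θ ≤ 1` and `a_i ≥ 0`, then `∏_T (1 + e_i/ε_h) − 1 ≤ θ · ε_Y (∏_T (1 + a_i/ε_Y) − 1)` (one-coin
monotonicity `rfun_anti` between the floor masses `ε_Y ≤ 1/θ`). [this work] -/
theorem vol_Ebound [DecidableEq κ] {εY εh θ : ℝ} (hεY : 0 < εY) (hεh : 0 < εh) (hθ : 0 ≤ θ) (hεYθ : εY * θ ≤ 1)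
    (T : Finset κ) (a e : κ → ℝ) (ha : ∀ i ∈ T, 0 ≤ a i) (he : ∀ i ∈ T, 0 ≤ e i)
    (hdom : ∀ i ∈ T, e i ≤ εh * θ * a i) :
    ∏ i ∈ T, (1 + e i / εh) - 1 ≤ θ * (εY * (∏ i ∈ T, (1 + a i / εY) - 1)) := by
  have h1 : ∏ i ∈ T, (1 + e i / εh) ≤ ∏ i ∈ T, (1 + θ * a i) := by
    refine prod_le_prod (fun i hi => ?_) (fun i hi => ?_)
    · have := div_nonneg (he i hi) hεh.le
      linarith
    · have h := hdom i hi
      have : e i / εh ≤ θ * a i := by rw [div_le_iff₀ hεh]; linarith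
      linarith
  rcases eq_or_lt_of_le hθ with hθ0 | hθpos
  · -- θ = 0: every factor is ≤ 1
    rw [← hθ0] at h1 ⊢
    simp only [zero_mul, add_zero, prod_const_one] at h1
    rw [zero_mul]
    linarith
  · have hθ' : εY ≤ 1 / θ := by rw [le_div_iff₀ hθpos]; linarith
    have h2 := rfun_anti T a ha hεY hθ'
    have h3 : ∏ i ∈ T, (1 + a i / (1 / θ)) = ∏ i ∈ T, (1 + θ * a i) := by
      refine prod_congr rfl (fun i _ => ?_)
      rw [div_div_eq_mul_div, div_one, mul_comm]
    rw [h3] at h2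
    have h5 : θ * (1 / θ * (∏ i ∈ T, (1 + θ * a i) - 1)) = ∏ i ∈ T, (1 + θ * a i) - 1 := by
      field_simp
    have h4 := mul_le_mul_of_nonneg_left h2 hθpos.le
    rw [h5] at h4
    linarith

/-- A product of factors `1 + c_i/ε` with `c_i ≥ 0`, `ε > 0` is at least `1`. -/
theorem one_le_prod_one_add_div {ε : ℝ} (hε : 0 < ε) (T : Finset κ) (c : κ → ℝ) (hc : ∀ i ∈ T, 0 ≤ c i) :
    1 ≤ ∏ i ∈ T, (1 + c i / ε) := by
  calc (1:ℝ) = ∏ i ∈ T, (1:ℝ) := by simp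
    _ ≤ ∏ i ∈ T, (1 + c i / ε) :=
      prod_le_prod (fun _ _ => zero_le_one) fun i hi => by have := div_nonneg (hc i hi) hε.le; linarith

/-! ## The theorem -/

/-- **LINKED TWO-CURRENCY LEMMA WITH VOLUNTARY `h`-EXCESS (every number of petals).**
Parameters `ε_Y, ε_g, ε_h > 0` with `ε_g + ε_h < 1`, `ρ > 0`, and the two caps `ε_g + ε_h ≤ (1/ε_Y − 1)·ρ ε_g`
(`ε_Y ≤ τ′`) and `ε_g + ε_h + ρ ε_g ≤ 1` (`ε_H ≤ 1 − τ′`).  Petals `j ∈ S` with excesses `a_j, m_j, e_j ≥ 0`, linked by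
`ρ m_j ≤ a_j` (`k ≥ g`) and `ε_h m_j ≤ ε_g e_j` (`g ≤ h`, no free `g`), and with `ε_h·ε_Y(∏(1 + a_j/ε_Y) − 1) ≤ ε_g`.
Then `∏ (1 + a_j + m_j + e_j) ≤ 1 + ε_Y(∏(1 + a_j/ε_Y) − 1) + (ε_g + ε_h)(∏(1 + e_j/ε_h) − 1)`.
No budget is assumed: the right side is the ACTUAL `Ȳ`-face and `h`-cell usage of the family.  Gen 52's
`linked_two_currency` is the case without voluntary excess; gen 53's `FreeHConj` (free `g`, i.e. `κ < 1`) is false.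
[this work] -/
theorem linked_two_currency_voluntary [DecidableEq κ] {εY εg εh ρ : ℝ} (hεY : 0 < εY) (hεg : 0 < εg)
    (hεh : 0 < εh) (hH1 : εg + εh < 1) (hρ : 0 < ρ) (hcap1 : εg + εh ≤ (1 / εY - 1) * (ρ * εg))
    (hcap2 : εg + εh + ρ * εg ≤ 1) (a m e : κ → ℝ) (S : Finset κ) (ha : ∀ j ∈ S, 0 ≤ a j)
    (hm : ∀ j ∈ S, 0 ≤ m j) (he : ∀ j ∈ S, 0 ≤ e j) (hlink : ∀ j ∈ S, ρ * m j ≤ a j)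
    (hunl : ∀ j ∈ S, εh * m j ≤ εg * e j) (hH : εh * (εY * (∏ j ∈ S, (1 + a j / εY) - 1)) ≤ εg) :
    ∏ j ∈ S, (1 + a j + m j + e j) ≤
      1 + εY * (∏ j ∈ S, (1 + a j / εY) - 1) + (εg + εh) * (∏ j ∈ S, (1 + e j / εh) - 1) := by
  -- scalar consequences of the caps, in `λ = 1/ρ` form
  obtain ⟨lam, hlam_def⟩ : ∃ v : ℝ, v = 1 / ρ := ⟨_, rfl⟩
  have hlam : 0 ≤ lam := by rw [hlam_def]; positivity
  have hρlam : ρ * lam = 1 := by rw [hlam_def]; field_simp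
  have hs1 : (εg + εh) * lam ≤ (1 / εY - 1) * εg := by
    have h := mul_le_mul_of_nonneg_right hcap1 hlam
    calc (εg + εh) * lam ≤ (1 / εY - 1) * (ρ * εg) * lam := h
      _ = (1 / εY - 1) * εg * (ρ * lam) := by ring
      _ = (1 / εY - 1) * εg := by rw [hρlam, mul_one]
  have hs2 : εg ≤ lam * (1 - (εg + εh)) := by
    have h1 : ρ * εg ≤ 1 - (εg + εh) := by linarith
    have h := mul_le_mul_of_nonneg_left h1 hlam
    calc εg = lam * (ρ * εg) := by rw [← mul_assoc, mul_comm lam, hρlam, one_mul]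
      _ ≤ lam * (1 - (εg + εh)) := h
  have hcapY : εY * (1 + lam) ≤ 1 - εh := by
    have e1 : (1 - εh) * (εg + (εg + εh) * lam) - (1 + lam) * εg = εh * (lam * (1 - (εg + εh)) - εg) := by ring
    have e2 : 0 ≤ εh * (lam * (1 - (εg + εh)) - εg) := mul_nonneg hεh.le (by linarith)
    have e3 : (1 - εh) * ((εg + εh) * lam) ≤ (1 - εh) * ((1 / εY - 1) * εg) :=
      mul_le_mul_of_nonneg_left hs1 (by linarith)
    have e4 : (1 - εh) * ((1 / εY - 1) * εg) = (1 - εh) * εg / εY - (1 - εh) * εg := by ring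
    have e5 : (1 + lam) * εg ≤ (1 - εh) * εg / εY := by linarith
    rw [le_div_iff₀ hεY] at e5
    have e6 : εY * (1 + lam) * εg ≤ (1 - εh) * εg := by linarith
    exact le_of_mul_le_mul_right e6 hεg
  -- induction over the family in increasing order of the h-share
  suffices key : ∀ T, T ⊆ S → ∏ j ∈ T, (1 + a j + m j + e j) ≤
      1 + εY * (∏ j ∈ T, (1 + a j / εY) - 1) + (εg + εh) * (∏ j ∈ T, (1 + e j / εh) - 1) from key S subset_rfl
  intro T
  refine Finset.induction_on_max_value (fun j => e j / (a j + m j + e j)) T (by intro; simp) ?_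
  intro j T hjT hmax IH hsub
  have hjS : j ∈ S := hsub (mem_insert_self j T)
  have hTS : T ⊆ S := fun i hi => hsub (mem_insert_of_mem hi)
  have IH' := IH hTS
  -- the running products
  obtain ⟨X, hXdef⟩ : ∃ v : ℝ, v = ∏ i ∈ T, (1 + a i / εY) := ⟨_, rfl⟩
  obtain ⟨R, hRdef⟩ : ∃ v : ℝ, v = ∏ i ∈ T, (1 + e i / εh) := ⟨_, rfl⟩
  rw [← hXdef, ← hRdef] at IH'
  have hX1 : 1 ≤ X := hXdef ▸ one_le_prod_one_add_div hεY T a fun i hi => ha i (hTS hi)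
  have hR1 : 1 ≤ R := hRdef ▸ one_le_prod_one_add_div hεh T e fun i hi => he i (hTS hi)
  have h𝒜 : 0 ≤ εY * (X - 1) := mul_nonneg hεY.le (by linarith)
  have hℰ : 0 ≤ (εg + εh) * (R - 1) := mul_nonneg (by linarith) (by linarith)
  -- X ≤ X_S, hence εh 𝒜 ≤ εg
  have hXS : X ≤ ∏ i ∈ S, (1 + a i / εY) := by
    rw [← prod_sdiff hTS, ← hXdef]
    have h1 : (1:ℝ) ≤ ∏ i ∈ S \ T, (1 + a i / εY) :=
      one_le_prod_one_add_div hεY _ a fun i hi => ha i (sdiff_subset hi)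
    have h2 := mul_le_mul_of_nonneg_right h1 (le_trans zero_le_one hX1)
    linarith
  have h𝒜g : εh * (εY * (X - 1)) ≤ εg := by
    have : εh * (εY * (X - 1)) ≤ εh * (εY * (∏ i ∈ S, (1 + a i / εY) - 1)) :=
      mul_le_mul_of_nonneg_left (mul_le_mul_of_nonneg_left (by linarith) hεY.le) hεh.le
    linarith
  -- petal j data
  have haj := ha j hjS; have hmj := hm j hjS; have hej := he j hjS
  have hVj : 0 ≤ 1 + a j + m j + e j := by linarith
  rw [prod_insert hjT, prod_insert hjT, prod_insert hjT, ← hXdef, ← hRdef]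
  -- step inequality  ε_h · (Φ_{T+j} − V_j Φ_T) = ε_h Δ ≥ 0
  have hF := vol_stepF (Q := 1 / εY - 1) hεg hεh hρ hcap1 h𝒜 h𝒜g haj (hlink j hjS) (hunl j hjS)
  have hΔ : 0 ≤ (εg * e j - εh * m j) + εh * (εY * (X - 1)) * (a j * (1 / εY - 1) - m j - e j) +
      (εg + εh) * (R - 1) * (e j - εh * (a j + m j + e j)) := by
    by_cases hβ : 0 ≤ e j - εh * (a j + m j + e j)
    · exact add_nonneg hF (mul_nonneg hℰ hβ)
    · have hβ' : e j - εh * (a j + m j + e j) < 0 := lt_of_not_ge hβ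
      have hb1 : e j * (1 - εh) < εh * (a j + m j) := by linarith
      have hP : 0 < a j + m j := by
        have h0 : 0 ≤ e j * (1 - εh) := mul_nonneg hej (by linarith)
        exact pos_of_mul_pos_right (lt_of_le_of_lt h0 hb1) hεh.le
      -- θ : the predecessors' h-usage per unit of Ȳ-excess
      obtain ⟨θ, hθdef⟩ : ∃ v : ℝ, v = e j * (1 + lam) / ((a j + m j) * εh) := ⟨_, rfl⟩
      have hθ : 0 ≤ θ := by rw [hθdef]; positivity
      have hεYθ : εY * θ ≤ 1 := by
        rw [hθdef, ← mul_div_assoc, div_le_one (mul_pos hP hεh)]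
        have h2 : εY * (1 + lam) * e j ≤ (1 - εh) * e j := mul_le_mul_of_nonneg_right hcapY hej
        linarith
      have hdom : ∀ i ∈ T, e i ≤ εh * θ * a i := by
        intro i hi
        have hiS := hTS hi
        have hai := ha i hiS; have hmi := hm i hiS; have hei := he i hiS
        have hθa : εh * θ * a i = e j * (1 + lam) * a i / (a j + m j) := by
          rw [hθdef]; field_simp
        rw [hθa, le_div_iff₀ hP]
        -- from the h-share order: e_i (a_j + m_j) ≤ e_j (a_i + m_i) ≤ e_j a_i (1 + lam)
        have hord := hmax i hi
        have hmi' : m i ≤ lam * a i := by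
          calc m i = lam * (ρ * m i) := by rw [← mul_assoc, mul_comm lam ρ, hρlam, one_mul]
            _ ≤ lam * a i := mul_le_mul_of_nonneg_left (hlink i hiS) hlam
        rcases eq_or_lt_of_le (show 0 ≤ a i + m i + e i by linarith) with h0 | hpos
        · have hei0 : e i = 0 := by linarith
          rw [hei0, zero_mul]; positivity
        · have htotj : 0 < a j + m j + e j := by linarith
          have hord' := (div_le_div_iff₀ hpos htotj).1 hord
          have hm2 : e j * m i ≤ e j * (lam * a i) := mul_le_mul_of_nonneg_left hmi' hej
          linarith
      have hEb := vol_Ebound hεY hεh hθ hεYθ T a e (fun i hi => ha i (hTS hi)) (fun i hi => he i (hTS hi)) hdom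
      rw [← hXdef, ← hRdef] at hEb
      -- ℰ ≤ εH θ 𝒜
      have hℰb : (εg + εh) * (R - 1) ≤ (εg + εh) * θ * (εY * (X - 1)) := by
        rw [mul_assoc]
        exact mul_le_mul_of_nonneg_left hEb (by linarith)
      have hK := vol_stepKey (Q := 1 / εY - 1) hεg hεh hH1 hs1 hs2 hlam h𝒜 haj hP (hunl j hjS)
      -- ℰ β ≥ εH θ 𝒜 β since β < 0
      have h1 : (εg + εh) * θ * (εY * (X - 1)) * (e j - εh * (a j + m j + e j)) ≤
          (εg + εh) * (R - 1) * (e j - εh * (a j + m j + e j)) :=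
        mul_le_mul_of_nonpos_right hℰb hβ'.le
      have h2 : (εg + εh) * (e j * (1 + lam) / (a j + m j)) * (εY * (X - 1)) * (e j - εh * (a j + m j + e j)) =
          εh * ((εg + εh) * θ * (εY * (X - 1)) * (e j - εh * (a j + m j + e j))) := by
        rw [hθdef]
        field_simp
      rw [h2] at hK
      have h3 : 0 ≤ εh * ((εg * e j - εh * m j) + εh * (εY * (X - 1)) * (a j * (1 / εY - 1) - m j - e j) +
          (εg + εh) * θ * (εY * (X - 1)) * (e j - εh * (a j + m j + e j))) := by
        have h4 : εh * ((εg * e j - εh * m j) + εh * (εY * (X - 1)) * (a j * (1 / εY - 1) - m j - e j) +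
            (εg + εh) * θ * (εY * (X - 1)) * (e j - εh * (a j + m j + e j))) =
            εh * (εg * e j - εh * m j) + εh ^ 2 * (εY * (X - 1)) * (a j * (1 / εY - 1) - m j - e j) +
            εh * ((εg + εh) * θ * (εY * (X - 1)) * (e j - εh * (a j + m j + e j))) := by ring
        rw [h4]; exact hK
      have h4 := (mul_nonneg_iff_of_pos_left hεh).1 h3
      linarith
  -- the identity  ε_h (Φ_{T+j} − V_j Φ_T) = ε_h Δ
  have hid : εh * ((1 + εY * ((1 + a j / εY) * X - 1) + (εg + εh) * ((1 + e j / εh) * R - 1)) -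
      (1 + a j + m j + e j) * (1 + εY * (X - 1) + (εg + εh) * (R - 1))) =
      (εg * e j - εh * m j) + εh * (εY * (X - 1)) * (a j * (1 / εY - 1) - m j - e j) +
        (εg + εh) * (R - 1) * (e j - εh * (a j + m j + e j)) := by
    field_simp
    ring
  have h5 : 0 ≤ εh * ((1 + εY * ((1 + a j / εY) * X - 1) + (εg + εh) * ((1 + e j / εh) * R - 1)) -
      (1 + a j + m j + e j) * (1 + εY * (X - 1) + (εg + εh) * (R - 1))) := by rw [hid]; exact hΔ
  have h6 := (mul_nonneg_iff_of_pos_left hεh).1 h5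
  calc (1 + a j + m j + e j) * ∏ i ∈ T, (1 + a i + m i + e i)
      ≤ (1 + a j + m j + e j) * (1 + εY * (X - 1) + (εg + εh) * (R - 1)) :=
        mul_le_mul_of_nonneg_left IH' hVj
    _ ≤ 1 + εY * ((1 + a j / εY) * X - 1) + (εg + εh) * ((1 + e j / εh) * R - 1) := by linarith


/-! ## Corollary: `FreeHConj`'s conclusion for `κ = 1`, without the `H`-face budget -/

/-- **The free-`h` problem WITHOUT free `g` (`κ = α₀₁/α₁₁ = 1`), every number of petals**: in the variables of gen 53's
`FreeHConj` at `κ = 1`, its conclusion `∏(1 + ε_Y(x_j − 1) + m_j + ε_h(r_j − 1)) ≤ 1 + ε_Y(X − 1) + ε_g(R − 1) + ε_h(R − 1)`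
from the `Ȳ`-face and `h`-cell budgets, the links, the caps and `ε_Y X ε_h ≤ (1 − ε_Y − ε_g − ε_h)ε_g` ALONE (no `H`-face
budget).  For `κ < 1` the analogue is false even with the `H`-face (gen 54's counterexample to `FreeHConj`). [this work] -/
theorem freeH_kappa_one [DecidableEq κ] (S : Finset κ) {τ' εY εg εh R X ρ : ℝ} (x m r : κ → ℝ)
    (hτ0 : 0 < τ') (hτ1 : τ' < 1) (hεY : 0 < εY) (hεYτ : εY ≤ τ') (hεg : 0 < εg) (hεh : 0 < εh)
    (hεgh : εg + εh ≤ 1 - τ') (hρ : 0 < ρ) (hρeq : ρ * ((1 - τ') * εg) = τ' * (εg + εh))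
    (hrel : εY * X * εh ≤ (1 - εY - εg - εh) * εg)
    (hx : ∀ j ∈ S, 1 ≤ x j) (hm : ∀ j ∈ S, 0 ≤ m j) (hlink : ∀ j ∈ S, ρ * m j ≤ εY * (x j - 1))
    (hr : ∀ j ∈ S, εg + m j ≤ εg * r j ∧ 1 ≤ r j)
    (hBx : ∏ j ∈ S, x j ≤ X) (hBr : ∏ j ∈ S, r j ≤ R) :
    ∏ j ∈ S, (1 + εY * (x j - 1) + m j + εh * (r j - 1)) ≤ 1 + εY * (X - 1) + εg * (R - 1) + εh * (R - 1) := by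
  have hτ1' : 0 < 1 - τ' := sub_pos.2 hτ1
  have hH1 : εg + εh < 1 := by linarith
  -- the two caps in the form of `linked_two_currency_voluntary`
  have hρεg : ρ * εg * (1 - τ') = τ' * (εg + εh) := by rw [← hρeq]; ring
  have hcap1 : εg + εh ≤ (1 / εY - 1) * (ρ * εg) := by
    -- (1/εY - 1) ρ εg (1-τ') = (1/εY - 1) τ' εH ≥ (1-τ') εH  since τ'/εY ≥ 1
    have h1 : (1 - τ') * (εg + εh) ≤ (1 / εY - 1) * (τ' * (εg + εh)) := by
      have h2 : 1 ≤ τ' / εY := by rw [le_div_iff₀ hεY]; linarith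
      have h3 : (1 / εY - 1) * τ' = τ' / εY - τ' := by ring
      nlinarith [mul_nonneg (by linarith : (0:ℝ) ≤ τ' / εY - 1) (by linarith : (0:ℝ) ≤ εg + εh)]
    rw [← hρεg] at h1
    have h4 : (1 - τ') * (εg + εh) ≤ (1 - τ') * ((1 / εY - 1) * (ρ * εg)) := by nlinarith
    exact le_of_mul_le_mul_left h4 hτ1'
  have hcap2 : εg + εh + ρ * εg ≤ 1 := by
    -- (εH + ρ εg)(1 - τ') = εH (1 - τ') + τ' εH = εH ≤ 1 - τ'
    have h1 : (εg + εh + ρ * εg) * (1 - τ') = εg + εh := by nlinarith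
    have h2 : (εg + εh + ρ * εg) * (1 - τ') ≤ 1 * (1 - τ') := by rw [h1, one_mul]; exact hεgh
    exact le_of_mul_le_mul_right h2 hτ1'
  -- the petals in excess variables
  have ha : ∀ j ∈ S, 0 ≤ εY * (x j - 1) := fun j hj => mul_nonneg hεY.le (by linarith [hx j hj])
  have he : ∀ j ∈ S, 0 ≤ εh * (r j - 1) := fun j hj => mul_nonneg hεh.le (by linarith [(hr j hj).2])
  have hunl : ∀ j ∈ S, εh * m j ≤ εg * (εh * (r j - 1)) := fun j hj => by
    have h := (hr j hj).1
    nlinarith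
  have hxprod : ∏ j ∈ S, (1 + εY * (x j - 1) / εY) = ∏ j ∈ S, x j :=
    prod_congr rfl fun j _ => by field_simp; ring
  have hrprod : ∏ j ∈ S, (1 + εh * (r j - 1) / εh) = ∏ j ∈ S, r j :=
    prod_congr rfl fun j _ => by field_simp; ring
  have hH : εh * (εY * (∏ j ∈ S, (1 + εY * (x j - 1) / εY) - 1)) ≤ εg := by
    rw [hxprod]
    have h1 : εh * (εY * (∏ j ∈ S, x j - 1)) ≤ εh * (εY * (X - 1)) :=
      mul_le_mul_of_nonneg_left (mul_le_mul_of_nonneg_left (by linarith) hεY.le) hεh.le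
    have h2 : (1 - εY - εg - εh) * εg ≤ 1 * εg := mul_le_mul_of_nonneg_right (by linarith) hεg.le
    nlinarith
  have main := linked_two_currency_voluntary hεY hεg hεh hH1 hρ hcap1 hcap2
    (fun j => εY * (x j - 1)) m (fun j => εh * (r j - 1)) S ha hm he hlink hunl hH
  rw [hxprod, hrprod] at main
  have h3 : εY * (∏ j ∈ S, x j - 1) ≤ εY * (X - 1) := mul_le_mul_of_nonneg_left (by linarith) hεY.le
  have h4 : (εg + εh) * (∏ j ∈ S, r j - 1) ≤ (εg + εh) * (R - 1) :=
    mul_le_mul_of_nonneg_left (by linarith) (by linarith)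
  calc ∏ j ∈ S, (1 + εY * (x j - 1) + m j + εh * (r j - 1))
      ≤ 1 + εY * (∏ j ∈ S, x j - 1) + (εg + εh) * (∏ j ∈ S, r j - 1) := main
    _ ≤ 1 + εY * (X - 1) + εg * (R - 1) + εh * (R - 1) := by linarith

end LinkedCurrency

end SafeCalc

end Summit.CriticalPhenomena.PercolationContinuityZ3.Theorems.SunflowerPartition
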